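import Mathlib
import Literature.Computability.AlgebraicComplexity.Apolarity
import Literature.Computability.AlgebraicComplexity.ApolarityAction
import Literature.Computability.AlgebraicComplexity.ApolarityTopPairing
import Literature.Computability.AlgebraicComplexity.BorderApolarityMembership
import Summits.ValiantsHypothesis.ValiantsHypothesis.Theorems.BorderApolarityToricFixedPointsToricLimitIsInitial
import Summits.ValiantsHypothesis.ValiantsHypothesis.Theorems.BorderApolarityFixedWitnessObstructionQPSocle
import Summits.ValiantsHypothesis.ValiantsHypothesis.Theorems.BorderApolarityFixedWitnessObstructionQPAnnSubmodule
import Summits.ValiantsHypothesis.ValiantsHypothesis.Theorems.BorderApolarityToricWitnessObstructionQPInitialFormApolarTop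
import Summits.ValiantsHypothesis.ValiantsHypothesis.Theorems.BorderApolarityToricWitnessObstructionQPInitialSpanDim
import Summits.ValiantsHypothesis.ValiantsHypothesis.Theorems.BorderApolarityToricWitnessObstructionQPNoPureOwn

/-!
# Border apolarity, crux `ToricFixedPoints` — the limit top form of a Kuratowski limit point (F2, helper file 1)

Route `ValiantsHypothesis/BorderApolarity`, crux item `stmt-ValiantsHypothesis-5779`
(`Summit.ValiantsHypothesis.ValiantsHypothesis.Theses.BorderApolarity.ToricFixedPoints`), strategist line
`form-then-lift`, helper file 1 for stub `stub_formToTop` (F2): the limit top form of an `H₀`-fixed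
Kuratowski limit point and the identification of the lowest-weight initial span with the annihilator
of the top weight component.

* `ftt_exists_limitForm` — for nonzero forms `P_t` of degree `j` and the degree-`j` Kuratowski limit
  `J j` of the annihilators `Ann_j(P_t)`: the weighted coefficient vectors of the `P_t`, normalised to
  the unit sphere of the finite coordinate space, have a convergent subsequence
  (`IsCompact.tendsto_subseq`); this gives `φ` strictly monotone, scalars `c_t ≠ 0` and a form
  `F ≠ 0` of degree `j` with `c_t • P_{φ t} → F` coefficientwise and `J j = Ann_j(F)` — "⊆" by
  passing to the limit in the top-degree pairing (`ftt_apolarAction_eq_zero_of_tendsto`, clause (Li)),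
  "⊇" by corrected annihilators (`Socle.mem_of_apolarAction_limit_eq_zero`, clause (Ls)).
* `ftt_exists_eq_smul_of_stable` — if `Ann_j(F)` is stable under `Mᵀ` (`M` invertible) then
  `M·F = e • F`: transport of annihilators (`apolarAction_linSubst_eq_zero_iff`) gives
  `Ann_j(F) ⊆ Ann_j(M·F)`, and two hyperplanes in containment have proportional normals
  (`Socle.exists_eq_smul_of_apolar_imp`).
* `formToTop_initialSpan_iff_annTop` (registered sub-goal) — for `f = g·det_m` with all `w`-weights `≤ e` and top component
  `f_e ≠ 0`, the lowest-`w`-weight initial span `in_w(Ann_m f)` equals `Ann_m(f_e)`: "⊆" because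
  initial forms of annihilators kill the top component (`initialForm_apolar_topComponent`), "=" by
  dimension (`snf_finrank_initialSpan`: `dim in_w(Ann_m f) = C(m²+m-1, m) - 1 = dim Hom_m - 1`, while
  `Ann_m(f_e)` is a proper subspace of `Hom_m` since `∂^{d₀} ⌟ f_e ≠ 0` for `d₀ ∈ supp f_e`).
-/

open MvPolynomial Filter
open scoped BigOperators Matrix Topology
open Literature.Computability.AlgebraicComplexity
open Summit.ValiantsHypothesis.ValiantsHypothesis.Theorems.BorderApolarityFixedWitnessObstructionQP
  (mem_homogeneousSubmodule_of_tendsto exists_annSubmodule finrank_homogeneousSubmodule_eq_choose_card)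
open Summit.ValiantsHypothesis.ValiantsHypothesis.Theorems.BorderApolarityFixedWitnessObstructionQP.Socle
  (mem_of_apolarAction_limit_eq_zero exists_eq_smul_of_apolar_imp)
open Summit.ValiantsHypothesis.ValiantsHypothesis.Theorems.BorderApolarityToricWitnessObstructionQP
  (initialForm_apolar_topComponent snf_finrank_initialSpan snfnp_apolarAction_monomial_self)

namespace Summit.ValiantsHypothesis.ValiantsHypothesis.Theorems.BorderApolarityToricFixedPoints

-- the mandated summit-side namespace repeats a component by design (single-problem summit)
set_option linter.dupNamespace false

noncomputable section

/-! ## 1. The limit top form of a Kuratowski limit point -/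

section LimitForm

variable {σ : Type*} [Fintype σ] [DecidableEq σ]

/-- **Continuity of the top-degree pairing.**  If degree-`j` forms `Ds t → D` and `Ps t → F`
coefficientwise (all of degree `j`) and `Ds t ⌟ Ps t = 0` for every `t`, then `D ⌟ F = 0`: the pairing
`Σ_d D_d F_d d!` is a finite sum of products of coordinates. [folklore] -/
theorem ftt_apolarAction_eq_zero_of_tendsto {j : ℕ} {Ds Ps : ℕ → MvPolynomial σ ℂ}
    {D F : MvPolynomial σ ℂ}
    (hDs : ∀ t, (Ds t).IsHomogeneous j) (hPs : ∀ t, (Ps t).IsHomogeneous j)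
    (hann : ∀ t, apolarAction (Ds t) (Ps t) = 0)
    (hD : D.IsHomogeneous j) (hF : F.IsHomogeneous j)
    (hlimD : Tendsto (fun t => coeffVec (Ds t)) atTop (𝓝 (coeffVec D)))
    (hlimP : Tendsto (fun t => coeffVec (Ps t)) atTop (𝓝 (coeffVec F))) :
    apolarAction D F = 0 := by
  rw [BorderApolarity.apolarAction_eq_zero_iff_sum hD hF]
  have h0 : ∀ t, (∑ d : ((Finset.univ : Finset σ).finsuppAntidiag j),
      coeff d.1 (Ds t) * (coeff d.1 (Ps t) * ∏ i ∈ d.1.support, ((d.1 i).factorial : ℂ))) = 0 :=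
    fun t => (BorderApolarity.apolarAction_eq_zero_iff_sum (hDs t) (hPs t)).1 (hann t)
  have hlim : Tendsto (fun t => ∑ d : ((Finset.univ : Finset σ).finsuppAntidiag j),
      coeff d.1 (Ds t) * (coeff d.1 (Ps t) * ∏ i ∈ d.1.support, ((d.1 i).factorial : ℂ))) atTop
      (𝓝 (∑ d : ((Finset.univ : Finset σ).finsuppAntidiag j),
        coeff d.1 D * (coeff d.1 F * ∏ i ∈ d.1.support, ((d.1 i).factorial : ℂ)))) := by
    refine tendsto_finsetSum _ fun d _ => ?_
    have h1 : Tendsto (fun t => coeffVec (Ds t) d.1) atTop (𝓝 (coeffVec D d.1)) :=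
      (continuous_apply d.1).continuousAt.tendsto.comp hlimD
    have h2 : Tendsto (fun t => coeffVec (Ps t) d.1) atTop (𝓝 (coeffVec F d.1)) :=
      (continuous_apply d.1).continuousAt.tendsto.comp hlimP
    simp only [coeffVec_apply] at h1 h2
    exact h1.mul (h2.mul_const _)
  have hfun : (fun t => ∑ d : ((Finset.univ : Finset σ).finsuppAntidiag j),
      coeff d.1 (Ds t) * (coeff d.1 (Ps t) * ∏ i ∈ d.1.support, ((d.1 i).factorial : ℂ))) =
      fun _ => 0 := funext h0
  rw [hfun] at hlim
  exact tendsto_nhds_unique hlim tendsto_const_nhds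

/-- **The limit top form.**  Let `P t ≠ 0` be forms of degree `j` and let `J j` be the degree-`j`
Kuratowski limit of the annihilators `Ann_j(P t)` ((Li) along the sequence, (Ls) along every
subsequence).  Then there are a strictly monotone `φ`, scalars `c t ≠ 0` and a form `F ≠ 0` of
degree `j` with `c t • P (φ t) → F` coefficientwise and `J j = Ann_j(F)`: normalise the weighted
coefficient vectors of the `P t` to the unit sphere of the finite coordinate space and extract a
convergent subsequence (compactness); "`J j ⊆ Ann_j(F)`" by continuity of the top pairing, "`⊇`" by
corrected annihilators (`Socle.mem_of_apolarAction_limit_eq_zero`). [folklore] -/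
theorem ftt_exists_limitForm {j : ℕ} {P : ℕ → MvPolynomial σ ℂ} {J : ℕ → Set (MvPolynomial σ ℂ)}
    (hPhom : ∀ t, (P t).IsHomogeneous j) (hPne : ∀ t, P t ≠ 0)
    (hLi : ∀ D ∈ J j, ∃ Ds : ℕ → MvPolynomial σ ℂ,
      (∀ t, (Ds t).IsHomogeneous j ∧ apolarAction (Ds t) (P t) = 0) ∧
        Tendsto (fun t => coeffVec (Ds t)) atTop (𝓝 (coeffVec D)))
    (hLs : ∀ (D : MvPolynomial σ ℂ) (φ : ℕ → ℕ) (Ds : ℕ → MvPolynomial σ ℂ), StrictMono φ →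
      (∀ t, (Ds t).IsHomogeneous j ∧ apolarAction (Ds t) (P (φ t)) = 0) →
      Tendsto (fun t => coeffVec (Ds t)) atTop (𝓝 (coeffVec D)) → D ∈ J j) :
    ∃ (F : MvPolynomial σ ℂ) (c : ℕ → ℂ) (φ : ℕ → ℕ), StrictMono φ ∧ F ≠ 0 ∧ F.IsHomogeneous j ∧
      (∀ t, c t ≠ 0) ∧
      Tendsto (fun t => coeffVec (c t • P (φ t))) atTop (𝓝 (coeffVec F)) ∧
      ∀ D, D ∈ J j ↔ D.IsHomogeneous j ∧ apolarAction D F = 0 := by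
  -- weighted coefficient vectors `w t`, normalised to the unit sphere: `v t`
  obtain ⟨w, hw⟩ : ∃ w : ℕ → (((Finset.univ : Finset σ).finsuppAntidiag j) → ℂ),
      ∀ t, w t = fun d => coeff d.1 (P t) * ∏ i ∈ d.1.support, ((d.1 i).factorial : ℂ) :=
    ⟨_, fun t => rfl⟩
  have hwne : ∀ t, w t ≠ 0 := fun t => by
    rw [hw]; exact BorderApolarity.weightedCoeff_ne_zero (hPhom t) (hPne t)
  have hnorm : ∀ t, ‖w t‖ ≠ 0 := fun t => norm_ne_zero_iff.2 (hwne t)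
  have hnormC : ∀ t, ((‖w t‖ : ℝ) : ℂ) ≠ 0 := fun t => Complex.ofReal_ne_zero.2 (hnorm t)
  obtain ⟨v, hv⟩ : ∃ v : ℕ → (((Finset.univ : Finset σ).finsuppAntidiag j) → ℂ),
      ∀ t, v t = ((‖w t‖ : ℝ) : ℂ)⁻¹ • w t := ⟨_, fun t => rfl⟩
  have hvs : ∀ t, v t ∈ Metric.sphere (0 : ((Finset.univ : Finset σ).finsuppAntidiag j) → ℂ) 1 := by
    intro t
    rw [mem_sphere_zero_iff_norm, hv, norm_smul, norm_inv, Complex.norm_real, norm_norm,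
      inv_mul_cancel₀ (hnorm t)]
  obtain ⟨u, hu, φ, hφ, hlim⟩ := (isCompact_sphere _ _).tendsto_subseq hvs
  have hlim1 : Tendsto (fun t => v (φ t)) atTop (𝓝 u) := hlim
  have hune : u ≠ 0 := by
    intro h
    rw [h, mem_sphere_zero_iff_norm, norm_zero] at hu
    exact zero_ne_one hu
  -- the limit form `F` with `F_d · d! = u_d`
  obtain ⟨F, hF⟩ : ∃ F : MvPolynomial σ ℂ, F = ∑ e : ((Finset.univ : Finset σ).finsuppAntidiag j),
      monomial e.1 ((∏ i ∈ e.1.support, ((e.1 i).factorial : ℂ))⁻¹ * u e) := ⟨_, rfl⟩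
  have hFcoeff : ∀ d : ((Finset.univ : Finset σ).finsuppAntidiag j),
      coeff d.1 F = (∏ i ∈ d.1.support, ((d.1 i).factorial : ℂ))⁻¹ * u d := fun d => by
    rw [hF, BorderApolarity.coeff_sum_monomial]
  have hFhom : F.IsHomogeneous j := hF ▸ BorderApolarity.isHomogeneous_sum_monomial _
  have hFne : F ≠ 0 := by
    intro h0
    apply hune
    funext d
    have h1 := hFcoeff d
    rw [h0, coeff_zero] at h1
    rcases mul_eq_zero.1 h1.symm with h2 | h2
    · exact absurd h2 (inv_ne_zero (BorderApolarity.prod_factorial_ne_zero d.1))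
    · exact h2
  -- the scalars `c t = ‖w (φ t)‖⁻¹`
  obtain ⟨c, hc⟩ : ∃ c : ℕ → ℂ, ∀ t, c t = ((‖w (φ t)‖ : ℝ) : ℂ)⁻¹ := ⟨_, fun t => rfl⟩
  have hcne : ∀ t, c t ≠ 0 := fun t => by
    rw [hc]; exact inv_ne_zero (hnormC (φ t))
  have hlim2 : Tendsto (fun t => coeffVec (c t • P (φ t))) atTop (𝓝 (coeffVec F)) := by
    rw [tendsto_pi_nhds]
    intro d
    by_cases hd : d.degree = j
    · have hdmem : d ∈ (Finset.univ : Finset σ).finsuppAntidiag j :=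
        BorderApolarity.mem_finsuppAntidiag_univ_iff.2 hd
      have hvd : Tendsto (fun t => v (φ t) ⟨d, hdmem⟩) atTop (𝓝 (u ⟨d, hdmem⟩)) :=
        ((continuous_apply _).tendsto u).comp hlim1
      have hfact : (∏ i ∈ d.support, ((d i).factorial : ℂ)) ≠ 0 :=
        BorderApolarity.prod_factorial_ne_zero d
      have hwd : ∀ t, w t ⟨d, hdmem⟩ = coeff d (P t) * ∏ i ∈ d.support, ((d i).factorial : ℂ) :=
        fun t => by rw [hw]
      have h1 : (fun t => coeffVec (c t • P (φ t)) d) =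
          fun t => (∏ i ∈ d.support, ((d i).factorial : ℂ))⁻¹ * v (φ t) ⟨d, hdmem⟩ := by
        funext t
        rw [coeffVec_apply, coeff_smul, smul_eq_mul, hc, hv]
        simp only [Pi.smul_apply, smul_eq_mul, hwd]
        field_simp
      have h2 : coeffVec F d = (∏ i ∈ d.support, ((d i).factorial : ℂ))⁻¹ * u ⟨d, hdmem⟩ := by
        rw [coeffVec_apply]
        exact hFcoeff ⟨d, hdmem⟩
      rw [h1, h2]
      exact hvd.const_mul _
    · have h1 : (fun t => coeffVec (c t • P (φ t)) d) = fun _ => 0 := by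
        funext t
        rw [coeffVec_apply, coeff_smul, (hPhom (φ t)).coeff_eq_zero hd, smul_zero]
      have h2 : coeffVec F d = 0 := hFhom.coeff_eq_zero hd
      rw [h1, h2]
      exact tendsto_const_nhds
  have hcPhom : ∀ t, (c t • P (φ t)).IsHomogeneous j := fun t => by
    rw [smul_eq_C_mul]
    exact (hPhom (φ t)).C_mul _
  refine ⟨F, c, φ, hφ, hFne, hFhom, hcne, hlim2, fun D => ⟨fun hD => ?_, fun hD => ?_⟩⟩
  · -- `J j ⊆ Ann_j(F)`: pass to the limit in the pairing along `φ`
    obtain ⟨Ds, hDs, hlimD⟩ := hLi D hD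
    have hDhom : D.IsHomogeneous j :=
      (mem_homogeneousSubmodule j D).1 (mem_homogeneousSubmodule_of_tendsto j
        (fun t => (mem_homogeneousSubmodule j _).2 (hDs t).1) hlimD)
    refine ⟨hDhom, ftt_apolarAction_eq_zero_of_tendsto (Ds := fun t => Ds (φ t))
      (Ps := fun t => c t • P (φ t)) (fun t => (hDs (φ t)).1) hcPhom (fun t => ?_) hDhom hFhom
      (hlimD.comp hφ.tendsto_atTop) hlim2⟩
    rw [apolarAction_smul_right, (hDs (φ t)).2, smul_zero]
  · -- `Ann_j(F) ⊆ J j`: corrected annihilators along `φ`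
    exact mem_of_apolarAction_limit_eq_zero (Q := fun t => P (φ t)) (J := J)
      (fun t => hPhom (φ t))
      (fun D' ψ Ds hψ hDs hl => hLs D' (fun t => φ (ψ t)) Ds (hφ.comp hψ) hDs hl)
      hcne hFhom hFne hlim2 hD.1 hD.2

/-- **Stability of `Ann_j(F)` under `Mᵀ` makes `F` an eigenform of `M`.**  If `F ≠ 0` is a form of
degree `j`, `S = Ann_j(F)` and `Mᵀ · S ⊆ S` for an invertible `M`, then `M · F = e • F`: transport of
annihilators gives `Ann_j(F) ⊆ Ann_j(M · F)`, and two hyperplanes of the degree-`j` operators in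
containment have proportional normals. [folklore] -/
theorem ftt_exists_eq_smul_of_stable {j : ℕ} {F : MvPolynomial σ ℂ} (hFhom : F.IsHomogeneous j)
    (hFne : F ≠ 0) {S : Set (MvPolynomial σ ℂ)}
    (hS : ∀ D, D ∈ S ↔ D.IsHomogeneous j ∧ apolarAction D F = 0)
    (M : Matrix σ σ ℂ) (hM : IsUnit M.det) (hstab : ∀ D ∈ S, linSubst σ ℂ Mᵀ D ∈ S) :
    ∃ e : ℂ, linSubst σ ℂ M F = e • F :=
  exists_eq_smul_of_apolar_imp hFhom hFne (linSubst_isHomogeneous M hFhom) fun D hD hDF =>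
    (apolarAction_linSubst_eq_zero_iff M hM D F).2 ((hS _).1 (hstab D ((hS D).2 ⟨hD, hDF⟩))).2

end LimitForm

/-! ## 2. The lowest-weight initial span of `Ann_m(g·det_m)` is `Ann_m` of the top component -/

section InitialSpan

/-- **`in_w(Ann_m(g·det_m)) = Ann_m(top_w(g·det_m))`.**  For `f = g·det_m` (`g ∈ GL_{m²}`), an
integer weight `w` and a level `e` bounding the `w`-weights of the monomials of `f` with nonzero top
component `f_e = weightedHomogeneousComponent w e f`, the span of the lowest-`w`-weight initial forms
of `Ann_m(f)` is exactly `Ann_m(f_e)`: initial forms of annihilators kill the top component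
(`initialForm_apolar_topComponent`), and both spaces are hyperplanes of the degree-`m` operators
(`snf_finrank_initialSpan`: `dim in_w(Ann_m f) = C(m²+m-1, m) - 1 = dim Hom_m - 1`;
`∂^{d₀} ⌟ f_e ≠ 0` for `d₀ ∈ supp f_e`). [folklore] -/
theorem formToTop_initialSpan_iff_annTop :
    ∀ (m : ℕ) (g : Matrix.GeneralLinearGroup (Fin m × Fin m) ℂ) (w : Fin m × Fin m → ℤ) (e : ℤ),
      (∀ d ∈ (linSubst (Fin m × Fin m) ℂ (g : Matrix (Fin m × Fin m) (Fin m × Fin m) ℂ)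
        (detPoly (Fin m) ℂ)).support, Finsupp.weight w d ≤ e) →
      weightedHomogeneousComponent w e
        (linSubst (Fin m × Fin m) ℂ (g : Matrix (Fin m × Fin m) (Fin m × Fin m) ℂ) (detPoly (Fin m) ℂ)) ≠ 0 →
      ∀ D : MvPolynomial (Fin m × Fin m) ℂ,
        D ∈ Submodule.span ℂ {D' : MvPolynomial (Fin m × Fin m) ℂ | ∃ E ∈ annihilatorOfDegree
            (linSubst (Fin m × Fin m) ℂ (g : Matrix (Fin m × Fin m) (Fin m × Fin m) ℂ) (detPoly (Fin m) ℂ)) m,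
          ∃ ν : ℤ, D' = weightedHomogeneousComponent w ν E ∧
            ∀ ν' : ℤ, ν' < ν → weightedHomogeneousComponent w ν' E = 0} ↔
        D ∈ annihilatorOfDegree (weightedHomogeneousComponent w e
          (linSubst (Fin m × Fin m) ℂ (g : Matrix (Fin m × Fin m) (Fin m × Fin m) ℂ) (detPoly (Fin m) ℂ))) m := by
  intro m g w e hwt hne D
  classical
  -- `f = g·det_m` is a form of degree `m`, hence so is its top component `fe`
  obtain ⟨f, hf⟩ : ∃ f : MvPolynomial (Fin m × Fin m) ℂ,
      f = linSubst (Fin m × Fin m) ℂ (g : Matrix (Fin m × Fin m) (Fin m × Fin m) ℂ) (detPoly (Fin m) ℂ) :=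
    ⟨_, rfl⟩
  rw [← hf] at hwt hne ⊢
  have hforb : f ∈ glOrbit (Fin m × Fin m) ℂ (detPoly (Fin m) ℂ) := ⟨g, hf.symm⟩
  have hfhom : f.IsHomogeneous m := by
    simpa [Fintype.card_fin] using BorderApolarity.isHomogeneous_of_mem_glOrbit_detPoly hforb
  have hfehom : (weightedHomogeneousComponent w e f).IsHomogeneous m :=
    tli_isHomogeneous_weightedHomogeneousComponent w e hfhom
  haveI : Module.Finite ℂ (homogeneousSubmodule (Fin m × Fin m) ℂ m) :=
    Module.Finite.iff_fg.2 (homogeneousSubmodule_fg (Fin m × Fin m) ℂ m)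
  -- the annihilator subspace `A` of the top component
  obtain ⟨A, hAcoe, hAle, -⟩ := exists_annSubmodule m (weightedHomogeneousComponent w e f)
  have hmemA : ∀ E, E ∈ A ↔ E ∈ annihilatorOfDegree (weightedHomogeneousComponent w e f) m :=
    fun E => by rw [← SetLike.mem_coe, hAcoe]
  haveI : FiniteDimensional ℂ A := Submodule.finiteDimensional_of_le hAle
  -- the initial span `In ≤ A`
  set In := Submodule.span ℂ {D' : MvPolynomial (Fin m × Fin m) ℂ | ∃ E ∈ annihilatorOfDegree f m,
    ∃ ν : ℤ, D' = weightedHomogeneousComponent w ν E ∧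
      ∀ ν' : ℤ, ν' < ν → weightedHomogeneousComponent w ν' E = 0} with hIn
  have hInA : In ≤ A := by
    refine Submodule.span_le.2 ?_
    rintro _ ⟨E, hE, ν, rfl, hlow⟩
    rw [SetLike.mem_coe, hmemA, mem_annihilatorOfDegree_iff]
    exact ⟨tli_isHomogeneous_weightedHomogeneousComponent w ν hE.1,
      initialForm_apolar_topComponent w f E e ν hwt hE.2 hlow⟩
  -- dimensions: `dim In = C(m²+m-1, m) - 1`, `dim A < dim Hom_m = C(m²+m-1, m)`
  have hInfin : Module.finrank ℂ In = Nat.choose (m * m + m - 1) m - 1 := by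
    have h := snf_finrank_initialSpan m m g w
    rw [Nat.choose_self, one_pow, ← hf] at h
    exact h
  have hHom : Module.finrank ℂ (homogeneousSubmodule (Fin m × Fin m) ℂ m) =
      Nat.choose (m * m + m - 1) m := by
    rw [finrank_homogeneousSubmodule_eq_choose_card, Fintype.card_prod, Fintype.card_fin]
  have hAlt : A < homogeneousSubmodule (Fin m × Fin m) ℂ m := by
    obtain ⟨d₀, hd₀⟩ := ne_zero_iff.1 hne
    have hd₀s : d₀ ∈ (weightedHomogeneousComponent w e f).support := mem_support_iff.2 hd₀
    have hd₀deg : d₀.degree = m := by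
      rw [Finsupp.degree_eq_weight_one]
      exact hfehom hd₀
    refine lt_of_le_of_ne hAle fun h => ?_
    have hmono : monomial d₀ (1 : ℂ) ∈ A := by
      rw [h]
      exact (mem_homogeneousSubmodule m _).2 (isHomogeneous_monomial _ hd₀deg)
    rw [hmemA, mem_annihilatorOfDegree_iff, snfnp_apolarAction_monomial_self hfehom hd₀s,
      C_eq_zero] at hmono
    refine mul_ne_zero hd₀ (Finset.prod_ne_zero_iff.2 fun i _ => ?_) hmono.2
    rw [Nat.descFactorial_self]
    exact_mod_cast Nat.factorial_ne_zero (d₀ i)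
  have hAfin : Module.finrank ℂ A < Nat.choose (m * m + m - 1) m :=
    hHom ▸ Submodule.finrank_lt_finrank_of_lt hAlt
  have hle : Module.finrank ℂ In ≤ Module.finrank ℂ A := Submodule.finrank_mono hInA
  have hInEq : In = A := Submodule.eq_of_le_of_finrank_eq hInA (by omega)
  change D ∈ In ↔ _
  rw [hInEq, hmemA]

end InitialSpan

end

end Summit.ValiantsHypothesis.ValiantsHypothesis.Theorems.BorderApolarityToricFixedPoints
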